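import Literature.Analysis.FluidPDE.FluidComputer.ThresholdLevelExit
import Literature.Analysis.FluidPDE.FluidComputer.ThresholdLevelEnclose
import HarnessLib

/-!
# The row checker of a dyadic level table (bp3 gen 12 → 13, layer 3)

HONEST FRAMING: low prior, high value-of-information experiment on Tao's machine paradigm; NOT a
claim that NS blows up.

`ThresholdLevelExit.lean` reduces the transfer stage of the threshold gate to the ROW CONDITIONS
`LevelTable.RowsValid` of a level table (crude side conditions, a pass chain of CONTAINMENTS
`S k 0 ⊇ crudeBox`, `S k (j+1) ⊇ refine (S k j)`, side conditions of the pass boxes, reach and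
speed at the last pass, and `B (k+1) ⊇ exitBox`).  This file makes those conditions DECIDABLE BY
THE KERNEL for a table of dyadic numbers `m / 2^P`:

* `LevelEntryD`, `WindowBoxD` — exact dyadic data boxes (integers at scale `2^P`), their real
  interpretations `toReal` and point-interval forms `toI`; `StepD`, `TableD` — a SELF-GENERATING
  level table: only the levels, caps, pass count and the initial entry box are data, the pass
  boxes `passBox` and entry boxes `TableD.entry` are COMPUTED by the interval twins and rounded
  outward (`roundOut`), so every containment of `RowsValid` holds by construction
  (`containsI_roundOut`); `TableD.toTable : LevelTable` is the generated real table;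
* `LevelEntryI.exitBox` — the interval twin of `LevelEntry.exitBox` (with `DI.sqrt`) and its
  runtime conditions `exitOK`, with the soundness theorem `LevelEntryI.Mem.exitBox`;
* `WindowBoxD.containsI` / `LevelEntryD.containsE` — the twelve / ten integer comparisons
  certifying that a data box CONTAINS an interval-enclosed real box, with
  `WindowBoxD.mem_of_containsI` / `LevelEntryD.mem_of_containsE`;
* `runPasses` / `runStep` / `runSteps : Option _` — the checker (side conditions of every pass
  box, runtime conditions of every pass and of the exit box, reach and speed), returning the
  final entry box, and
* `runSteps_append` / `runSteps_append_some` — chunking of a long run into consecutive runs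
  (so that the kernel evaluation can be split across theorems / files), and
* **`TableD.rowsValid_of_runSteps`**: `runSteps … T.B0 T.steps T.CN = some BN →
  (T.toTable …).RowsValid G Rb ∧ T.entry … N = BN` for any real gate data `G` and ball radius
  `Rb` enclosed by the interval data `GI`, `RbI`.

With it, an explicit list of levels and caps (chosen outside Lean; no bit-exact mirror of the
interval arithmetic is needed any more) is certified by ONE kernel evaluation
`example : runSteps P n K GI RbI B0 steps CN = some BN := by decide +kernel`, after which
`levelTableStage_reach` applies with `hexit` read off `BN`.  Layer 4 (the levels and caps at the
design point A = 2, od = 20, 800 levels) and layer 5 (the instantiated reach theorem with its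
energy margin and time budget) are gen 13.
-/

noncomputable section

open Set

namespace Literature.Analysis.FluidPDE.FluidComputer

open Literature.Analysis.FluidPDE.Tao2016AveragedNS

namespace DI

/-- [folklore] -/
theorem cast_div_le_of_le_lo {P : ℕ} {a : ℤ} {I : DI} {x v : ℝ} (h : a ≤ I.lo) (hI : I.mem P x)
    (hx : x ≤ v) : (a : ℝ) / 2 ^ P ≤ v := by
  have h2P : (0 : ℝ) < 2 ^ P := pow_pos two_pos P
  rw [div_le_iff₀ h2P]
  have h' : (a : ℝ) ≤ I.lo := by exact_mod_cast h
  exact h'.trans (hI.1.trans (mul_le_mul_of_nonneg_right hx h2P.le))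

/-- [folklore] -/
theorem le_cast_div_of_hi_le {P : ℕ} {b : ℤ} {I : DI} {x v : ℝ} (h : I.hi ≤ b) (hI : I.mem P x)
    (hx : v ≤ x) : v ≤ (b : ℝ) / 2 ^ P := by
  have h2P : (0 : ℝ) < 2 ^ P := pow_pos two_pos P
  rw [le_div_iff₀ h2P]
  have h' : (I.hi : ℝ) ≤ b := by exact_mod_cast h
  exact ((mul_le_mul_of_nonneg_right hx h2P.le).trans hI.2).trans h'

end DI

/-! ### Exact dyadic data records -/

/-- Entry box with dyadic ends (integers at scale `2^P`). [folklore] -/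
structure LevelEntryD where
  /-- the ten ends -/
  al : ℤ
  ah : ℤ
  bl : ℤ
  bh : ℤ
  wl : ℤ
  wh : ℤ
  zl : ℤ
  zh : ℤ
  El : ℤ
  Eh : ℤ
  deriving DecidableEq

namespace LevelEntryD

/-- [folklore] -/
def toReal (P : ℕ) (E : LevelEntryD) : LevelEntry :=
  { al := (E.al : ℝ) / 2 ^ P, ah := (E.ah : ℝ) / 2 ^ P, bl := (E.bl : ℝ) / 2 ^ P,
    bh := (E.bh : ℝ) / 2 ^ P, wl := (E.wl : ℝ) / 2 ^ P, wh := (E.wh : ℝ) / 2 ^ P,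
    zl := (E.zl : ℝ) / 2 ^ P, zh := (E.zh : ℝ) / 2 ^ P, El := (E.El : ℝ) / 2 ^ P,
    Eh := (E.Eh : ℝ) / 2 ^ P }

/-- [folklore] -/
def toI (E : LevelEntryD) : LevelEntryI :=
  { al := DI.pt E.al, ah := DI.pt E.ah, bl := DI.pt E.bl, bh := DI.pt E.bh, wl := DI.pt E.wl,
    wh := DI.pt E.wh, zl := DI.pt E.zl, zh := DI.pt E.zh, El := DI.pt E.El, Eh := DI.pt E.Eh }

/-- [folklore] -/
theorem toI_mem (P : ℕ) (E : LevelEntryD) : E.toI.Mem P (E.toReal P) :=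
  ⟨DI.mem_pt P _, DI.mem_pt P _, DI.mem_pt P _, DI.mem_pt P _, DI.mem_pt P _, DI.mem_pt P _,
    DI.mem_pt P _, DI.mem_pt P _, DI.mem_pt P _, DI.mem_pt P _⟩

/-- The ten integer comparisons certifying `T ⊇ (any box enclosed by R)`. [folklore] -/
def containsE (T : LevelEntryD) (R : LevelEntryI) : Bool :=
  decide (T.al ≤ R.al.lo) && decide (R.ah.hi ≤ T.ah) && decide (T.bl ≤ R.bl.lo) &&
    decide (R.bh.hi ≤ T.bh) && decide (T.wl ≤ R.wl.lo) && decide (R.wh.hi ≤ T.wh) &&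
    decide (T.zl ≤ R.zl.lo) && decide (R.zh.hi ≤ T.zh) && decide (T.El ≤ R.El.lo) &&
    decide (R.Eh.hi ≤ T.Eh)

/-- [folklore] -/
theorem mem_of_containsE {P : ℕ} {T : LevelEntryD} {R : LevelEntryI} {E : LevelEntry}
    (hc : T.containsE R = true) (hR : R.Mem P E) {κ r C : ℝ} {X : Fin 5 → ℝ}
    (hX : E.mem κ r C X) : (T.toReal P).mem κ r C X := by
  simp only [containsE, Bool.and_eq_true, decide_eq_true_eq] at hc
  obtain ⟨⟨⟨⟨⟨⟨⟨⟨⟨c1, c2⟩, c3⟩, c4⟩, c5⟩, c6⟩, c7⟩, c8⟩, c9⟩, c10⟩ := hc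
  obtain ⟨⟨h1, h2⟩, ⟨h3, h4⟩, h5, ⟨h6, h7⟩, ⟨h8, h9⟩, ⟨h10, h11⟩⟩ := hX
  exact ⟨⟨DI.cast_div_le_of_le_lo c1 hR.al h1, DI.le_cast_div_of_hi_le c2 hR.ah h2⟩,
    ⟨DI.cast_div_le_of_le_lo c3 hR.bl h3, DI.le_cast_div_of_hi_le c4 hR.bh h4⟩, h5,
    ⟨DI.cast_div_le_of_le_lo c5 hR.wl h6, DI.le_cast_div_of_hi_le c6 hR.wh h7⟩,
    ⟨DI.cast_div_le_of_le_lo c7 hR.zl h8, DI.le_cast_div_of_hi_le c8 hR.zh h9⟩,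
    ⟨DI.cast_div_le_of_le_lo c9 hR.El h10, DI.le_cast_div_of_hi_le c10 hR.Eh h11⟩⟩

end LevelEntryD

/-- Window box with dyadic ends. [folklore] -/
structure WindowBoxD where
  /-- the twelve ends -/
  Aℓ : ℤ
  Ah : ℤ
  Bℓ : ℤ
  Bh : ℤ
  cℓ : ℤ
  ch : ℤ
  Dℓ : ℤ
  Dh : ℤ
  Zℓ : ℤ
  Zh : ℤ
  Wℓ : ℤ
  Wh : ℤ
  deriving DecidableEq

namespace WindowBoxD

/-- [folklore] -/
def zero : WindowBoxD := ⟨0, 0, 0, 0, 0, 0, 0, 0, 0, 0, 0, 0⟩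

/-- [folklore] -/
def toReal (P : ℕ) (T : WindowBoxD) : WindowBox :=
  { Aℓ := (T.Aℓ : ℝ) / 2 ^ P, Ah := (T.Ah : ℝ) / 2 ^ P, Bℓ := (T.Bℓ : ℝ) / 2 ^ P,
    Bh := (T.Bh : ℝ) / 2 ^ P, cℓ := (T.cℓ : ℝ) / 2 ^ P, ch := (T.ch : ℝ) / 2 ^ P,
    Dℓ := (T.Dℓ : ℝ) / 2 ^ P, Dh := (T.Dh : ℝ) / 2 ^ P, Zℓ := (T.Zℓ : ℝ) / 2 ^ P,
    Zh := (T.Zh : ℝ) / 2 ^ P, Wℓ := (T.Wℓ : ℝ) / 2 ^ P, Wh := (T.Wh : ℝ) / 2 ^ P }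

/-- [folklore] -/
def toI (T : WindowBoxD) : WindowBoxI :=
  { Aℓ := DI.pt T.Aℓ, Ah := DI.pt T.Ah, Bℓ := DI.pt T.Bℓ, Bh := DI.pt T.Bh, cℓ := DI.pt T.cℓ,
    ch := DI.pt T.ch, Dℓ := DI.pt T.Dℓ, Dh := DI.pt T.Dh, Zℓ := DI.pt T.Zℓ, Zh := DI.pt T.Zh,
    Wℓ := DI.pt T.Wℓ, Wh := DI.pt T.Wh }

/-- [folklore] -/
theorem toI_mem (P : ℕ) (T : WindowBoxD) : T.toI.Mem P (T.toReal P) :=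
  ⟨DI.mem_pt P _, DI.mem_pt P _, DI.mem_pt P _, DI.mem_pt P _, DI.mem_pt P _, DI.mem_pt P _,
    DI.mem_pt P _, DI.mem_pt P _, DI.mem_pt P _, DI.mem_pt P _, DI.mem_pt P _, DI.mem_pt P _⟩

/-- The twelve integer comparisons certifying `T ⊇ (any box enclosed by R)`. [folklore] -/
def containsI (T : WindowBoxD) (R : WindowBoxI) : Bool :=
  decide (T.Aℓ ≤ R.Aℓ.lo) && decide (R.Ah.hi ≤ T.Ah) && decide (T.Bℓ ≤ R.Bℓ.lo) &&
    decide (R.Bh.hi ≤ T.Bh) && decide (T.cℓ ≤ R.cℓ.lo) && decide (R.ch.hi ≤ T.ch) &&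
    decide (T.Dℓ ≤ R.Dℓ.lo) && decide (R.Dh.hi ≤ T.Dh) && decide (T.Zℓ ≤ R.Zℓ.lo) &&
    decide (R.Zh.hi ≤ T.Zh) && decide (T.Wℓ ≤ R.Wℓ.lo) && decide (R.Wh.hi ≤ T.Wh)

/-- [folklore] -/
theorem mem_of_containsI {P : ℕ} {T : WindowBoxD} {R : WindowBoxI} {S : WindowBox}
    (hc : T.containsI R = true) (hR : R.Mem P S) {κ r : ℝ} {X : Fin 5 → ℝ}
    (hX : S.mem κ r X) : (T.toReal P).mem κ r X := by
  simp only [containsI, Bool.and_eq_true, decide_eq_true_eq] at hc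
  obtain ⟨⟨⟨⟨⟨⟨⟨⟨⟨⟨⟨c1, c2⟩, c3⟩, c4⟩, c5⟩, c6⟩, c7⟩, c8⟩, c9⟩, c10⟩, c11⟩, c12⟩ := hc
  obtain ⟨⟨h1, h2⟩, ⟨h3, h4⟩, ⟨h5, h6⟩, ⟨h7, h8⟩, ⟨h9, h10⟩, ⟨h11, h12⟩⟩ := hX
  exact ⟨⟨DI.cast_div_le_of_le_lo c1 hR.Aℓ h1, DI.le_cast_div_of_hi_le c2 hR.Ah h2⟩,
    ⟨DI.cast_div_le_of_le_lo c3 hR.Bℓ h3, DI.le_cast_div_of_hi_le c4 hR.Bh h4⟩,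
    ⟨DI.cast_div_le_of_le_lo c5 hR.cℓ h5, DI.le_cast_div_of_hi_le c6 hR.ch h6⟩,
    ⟨DI.cast_div_le_of_le_lo c7 hR.Dℓ h7, DI.le_cast_div_of_hi_le c8 hR.Dh h8⟩,
    ⟨DI.cast_div_le_of_le_lo c9 hR.Zℓ h9, DI.le_cast_div_of_hi_le c10 hR.Zh h10⟩,
    ⟨DI.cast_div_le_of_le_lo c11 hR.Wℓ h11, DI.le_cast_div_of_hi_le c12 hR.Wh h12⟩⟩

end WindowBoxD

/-! ### The interval twin of the exit box -/

namespace LevelEntryI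

variable (P n : ℕ) (GI : GateDataI) (BI : LevelEntryI) (SI : WindowBoxI) (RbI hI CI C'I : DI)

/-- twin of `LevelEntry.exitBox` [folklore] -/
def exitBox : LevelEntryI :=
  let tlo := (C'I.sub CI).div P (SI.ρh P GI)
  let thi := ((C'I.sub CI).div P (SI.ρℓ P GI)).min hI
  let a_l := (SI.aFloor P n GI BI.al tlo).min (SI.aFloor P n GI BI.al thi)
  let a_h := (SI.aCeil P n GI BI.ah tlo).max (SI.aCeil P n GI BI.ah thi)
  let b_l := (BI.bl.add ((SI.βℓ P GI).mul P tlo)).min (BI.bl.add ((SI.βℓ P GI).mul P thi))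
  let b_h := (BI.bh.add ((SI.βh P GI).mul P tlo)).max (BI.bh.add ((SI.βh P GI).mul P thi))
  let w_l := (SI.wFloor P n GI BI.wl tlo).min (SI.wFloor P n GI BI.wl thi)
  let w_h := (SI.wCeil P n GI BI.wh tlo).max (SI.wCeil P n GI BI.wh thi)
  let z_l := SI.Zℓ.max ((BI.zl.add ((SI.ζℓ P GI).mul P tlo)).min (BI.zl.add ((SI.ζℓ P GI).mul P thi)))
  let z_h := (BI.zh.add ((SI.ζh P GI).mul P tlo)).max (BI.zh.add ((SI.ζh P GI).mul P thi))
  let d_l := (DI.pt 0).max ((w_l.add ((GI.r.mul P C'I).mul P (a_l.max (DI.pt 0)))).div P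
    (GI.κ.mul P z_h))
  let d_h := (w_h.add ((GI.r.mul P C'I).mul P a_h)).div P (GI.κ.mul P z_l)
  let El' := BI.El.sub (((GI.δ.mul P RbI).smul 10).mul P hI)
  let Eh' := BI.Eh.add (((GI.δ.mul P RbI).smul 10).mul P hI)
  let bmax2 := (b_l.abs.max b_h.abs).sq P
  let bmin2 := (b_l.max (DI.pt 0)).sq P
  let z_l' := z_l.max (DI.sqrt P ((((El'.sub (a_h.sq P)).sub bmax2).sub (C'I.sq P)).sub (d_h.sq P)))
  let z_h' := z_h.min (DI.sqrt P ((((Eh'.sub ((a_l.max (DI.pt 0)).sq P)).sub bmin2).sub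
    (C'I.sq P)).sub (d_l.sq P)))
  let a_h' := a_h.min (DI.sqrt P ((((Eh'.sub bmin2).sub (C'I.sq P)).sub (z_l'.sq P)).sub (d_l.sq P)))
  let a_l' := a_l.max (DI.sqrt P ((((El'.sub bmax2).sub (C'I.sq P)).sub (z_h'.sq P)).sub (d_h.sq P)))
  { al := a_l', ah := a_h', bl := b_l, bh := b_h, wl := w_l, wh := w_h, zl := z_l', zh := z_h',
    El := El', Eh := Eh' }

/-- Runtime conditions of the exit box: positive rate floors / divisors, nonpositive exponents at
both ends of the exit-time bracket. [folklore] -/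
def exitOK : Bool :=
  let tlo := (C'I.sub CI).div P (SI.ρh P GI)
  let thi := ((C'I.sub CI).div P (SI.ρℓ P GI)).min hI
  let z_l := SI.Zℓ.max ((BI.zl.add ((SI.ζℓ P GI).mul P tlo)).min (BI.zl.add ((SI.ζℓ P GI).mul P thi)))
  let z_h := (BI.zh.add ((SI.ζh P GI).mul P tlo)).max (BI.zh.add ((SI.ζh P GI).mul P thi))
  DI.posB (SI.ρh P GI) && DI.posB (SI.ρℓ P GI) &&
    DI.posB (GI.κ.mul P SI.Zℓ) && DI.posB (GI.κ.mul P SI.Zh) &&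
    DI.posB (SI.Λh P GI) && DI.posB (SI.Λℓ P GI) &&
    decide ((((SI.Λh P GI).neg).mul P tlo).hi ≤ 0) &&
    decide ((((SI.Λh P GI).neg).mul P thi).hi ≤ 0) &&
    decide ((((SI.Λℓ P GI).neg).mul P tlo).hi ≤ 0) &&
    decide ((((SI.Λℓ P GI).neg).mul P thi).hi ≤ 0) &&
    decide ((((GI.κ.mul P SI.Zh).neg).mul P tlo).hi ≤ 0) &&
    decide ((((GI.κ.mul P SI.Zh).neg).mul P thi).hi ≤ 0) &&
    decide ((((GI.κ.mul P SI.Zℓ).neg).mul P tlo).hi ≤ 0) &&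
    decide ((((GI.κ.mul P SI.Zℓ).neg).mul P thi).hi ≤ 0) &&
    DI.posB (GI.κ.mul P z_h) && DI.posB (GI.κ.mul P z_l)

end LevelEntryI

namespace LevelEntryI.Mem

open DI

variable {P n : ℕ} {GI : GateDataI} {G : GateData} {BI : LevelEntryI} {B : LevelEntry}
  {SI : WindowBoxI} {S : WindowBox} {RbI hI CI C'I : DI} {Rb h C C' : ℝ}

/-- **Soundness of the exit-box twin.** [folklore] -/
theorem exitBox (hn : 0 < n) (hG : GI.Mem P G) (hB : BI.Mem P B) (hS : SI.Mem P S)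
    (hRb : RbI.mem P Rb) (hh : hI.mem P h) (hC : CI.mem P C) (hC' : C'I.mem P C')
    (hok : BI.exitOK P GI SI hI CI C'I = true) :
    (BI.exitBox P n GI SI RbI hI CI C'I).Mem P (B.exitBox G S Rb h C C') := by
  simp only [LevelEntryI.exitOK, Bool.and_eq_true, decide_eq_true_eq] at hok
  obtain ⟨⟨⟨⟨⟨⟨⟨⟨⟨⟨⟨⟨⟨⟨⟨e1, e2⟩, k1⟩, k2⟩, k3⟩, k3'⟩, t1⟩, t2⟩, t3⟩, t4⟩, t5⟩, t6⟩, t7⟩, t8⟩,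
    d1⟩, d2⟩ := hok
  have htlo := mem_div (of_decide_eq_true e1) (mem_sub hC' hC) (WindowBoxI.Mem.ρh hG hS)
  have hthi := mem_min (mem_div (of_decide_eq_true e2) (mem_sub hC' hC)
    (WindowBoxI.Mem.ρℓ hG hS)) hh
  have hal := mem_min (WindowBoxI.Mem.aFloor hn hG hS k1 k2 k3 t1 hB.al htlo)
    (WindowBoxI.Mem.aFloor hn hG hS k1 k2 k3 t2 hB.al hthi)
  have hah := mem_max (WindowBoxI.Mem.aCeil hn hG hS k1 k2 k3' t3 hB.ah htlo)
    (WindowBoxI.Mem.aCeil hn hG hS k1 k2 k3' t4 hB.ah hthi)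
  have hbl := mem_min (mem_add hB.bl (mem_mul (WindowBoxI.Mem.βℓ hG hS) htlo))
    (mem_add hB.bl (mem_mul (WindowBoxI.Mem.βℓ hG hS) hthi))
  have hbh := mem_max (mem_add hB.bh (mem_mul (WindowBoxI.Mem.βh hG hS) htlo))
    (mem_add hB.bh (mem_mul (WindowBoxI.Mem.βh hG hS) hthi))
  have hwl := mem_min (WindowBoxI.Mem.wFloor hn hG hS k2 t5 hB.wl htlo)
    (WindowBoxI.Mem.wFloor hn hG hS k2 t6 hB.wl hthi)
  have hwh := mem_max (WindowBoxI.Mem.wCeil hn hG hS k1 t7 hB.wh htlo)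
    (WindowBoxI.Mem.wCeil hn hG hS k1 t8 hB.wh hthi)
  have hzl := mem_max hS.Zℓ (mem_min (mem_add hB.zl (mem_mul (WindowBoxI.Mem.ζℓ hG hS) htlo))
    (mem_add hB.zl (mem_mul (WindowBoxI.Mem.ζℓ hG hS) hthi)))
  have hzh := mem_max (mem_add hB.zh (mem_mul (WindowBoxI.Mem.ζh hG hS) htlo))
    (mem_add hB.zh (mem_mul (WindowBoxI.Mem.ζh hG hS) hthi))
  have hdl := mem_max (mem_zero P) (mem_div (of_decide_eq_true d1)
    (mem_add hwl (mem_mul (mem_mul hG.r hC') (mem_max hal (mem_zero P)))) (mem_mul hG.κ hzh))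
  have hdh := mem_div (of_decide_eq_true d2) (mem_add hwh (mem_mul (mem_mul hG.r hC') hah))
    (mem_mul hG.κ hzl)
  have h10 := mem_mul (mem_smul 10 (mem_mul hG.δ hRb)) hh
  have h10' : (((GI.δ.mul P RbI).smul 10).mul P hI).mem P (10 * (G.δ * Rb) * h) := by
    simpa using h10
  have hEl := mem_sub hB.El h10'
  have hEh := mem_add hB.Eh h10'
  have hbmax := mem_sq (mem_max (mem_abs hbl) (mem_abs hbh))
  have hbmin := mem_sq (mem_max hbl (mem_zero P))
  have hzl' := mem_max hzl (mem_sqrt (mem_sub (mem_sub (mem_sub (mem_sub hEl (mem_sq hah)) hbmax)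
    (mem_sq hC')) (mem_sq hdh)))
  have hzh' := mem_min hzh (mem_sqrt (mem_sub (mem_sub (mem_sub (mem_sub hEh
    (mem_sq (mem_max hal (mem_zero P)))) hbmin) (mem_sq hC')) (mem_sq hdl)))
  have hah' := mem_min hah (mem_sqrt (mem_sub (mem_sub (mem_sub (mem_sub hEh hbmin) (mem_sq hC'))
    (mem_sq hzl')) (mem_sq hdl)))
  have hal' := mem_max hal (mem_sqrt (mem_sub (mem_sub (mem_sub (mem_sub hEl hbmax) (mem_sq hC'))
    (mem_sq hzh')) (mem_sq hdh)))
  exact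
    { al := hal', ah := hah', bl := hbl, bh := hbh, wl := hwl, wh := hwh, zl := hzl', zh := hzh',
      El := hEl, Eh := hEh }

end LevelEntryI.Mem

/-! ### Outward rounding of interval boxes to data boxes -/

namespace WindowBoxI

/-- Outward rounding: floors take the lower ends, ceilings the upper ends. [folklore] -/
def roundOut (R : WindowBoxI) : WindowBoxD :=
  ⟨R.Aℓ.lo, R.Ah.hi, R.Bℓ.lo, R.Bh.hi, R.cℓ.lo, R.ch.hi, R.Dℓ.lo, R.Dh.hi, R.Zℓ.lo, R.Zh.hi,
    R.Wℓ.lo, R.Wh.hi⟩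

/-- [folklore] -/
theorem containsI_roundOut (R : WindowBoxI) : R.roundOut.containsI R = true := by
  simp [roundOut, WindowBoxD.containsI]

end WindowBoxI

namespace LevelEntryI

/-- Outward rounding of an interval entry box. [folklore] -/
def roundOut (R : LevelEntryI) : LevelEntryD :=
  ⟨R.al.lo, R.ah.hi, R.bl.lo, R.bh.hi, R.wl.lo, R.wh.hi, R.zl.lo, R.zh.hi, R.El.lo, R.Eh.hi⟩

/-- [folklore] -/
theorem containsE_roundOut (R : LevelEntryI) : R.roundOut.containsE R = true := by
  simp [roundOut, LevelEntryD.containsE]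

end LevelEntryI

/-! ### The self-generating level table and its checker

Only the levels `C k`, the caps `h k`, the pass count `K` and the INITIAL entry box are data: the
pass boxes and the later entry boxes are COMPUTED by the interval twins and rounded outward, so
every containment of `RowsValid` holds by construction and the checker only has to decide the
side conditions, the runtime conditions, reach and speed. -/

/-- One step of a level table: the level `C k` it starts from and its time cap `h k`. [folklore] -/
structure StepD where
  /-- level -/
  C : ℤ
  /-- time cap -/
  h : ℤ
  deriving DecidableEq

/-- A dyadic level table: initial entry box, the steps of levels `0, …, N-1`, the final level.
[folklore] -/
structure TableD where
  /-- entry box at level `0` -/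
  B0 : LevelEntryD
  /-- steps -/
  steps : List StepD
  /-- final level `C N` -/
  CN : ℤ

section checker

variable (P n K : ℕ) (GI : GateDataI) (RbI : DI)

/-- The pass boxes `S 0 = ⌈crudeBox⌉`, `S (j+1) = ⌈refine (S j)⌉` of one step. [folklore] -/
def passBox (B : LevelEntryD) (C h C' : ℤ) : ℕ → WindowBoxD
  | 0 => (LevelEntryI.crudeBox P n GI B.toI RbI (DI.pt h) (DI.pt C) (DI.pt C')).roundOut
  | j + 1 => ((passBox B C h C' j).toI.refine P n GI B.toI (DI.pt h) (DI.pt C)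
      (DI.pt C')).roundOut

/-- The next entry box `⌈exitBox (S K)⌉`. [folklore] -/
def nextEntry (B : LevelEntryD) (C h C' : ℤ) : LevelEntryD :=
  (B.toI.exitBox P n GI (passBox P n GI RbI B C h C' K).toI RbI (DI.pt h) (DI.pt C)
    (DI.pt C')).roundOut

/-- Pass runner: from the current pass box with `m` passes to go, check the side conditions of
every box and the runtime conditions of every pass; return the final box. [folklore] -/
def runPasses (B : LevelEntryD) (C h C' : ℤ) : ℕ → WindowBoxD → Option WindowBoxD
  | 0, S => bif S.toI.sidesB P GI then some S else none
  | m + 1, S =>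
    bif S.toI.sidesB P GI && S.toI.refineOK P n GI B.toI (DI.pt h) (DI.pt C) (DI.pt C') then
      runPasses B C h C' m
        ((S.toI.refine P n GI B.toI (DI.pt h) (DI.pt C) (DI.pt C')).roundOut)
    else none

/-- Step runner: all checks of one level step; returns the next entry box. [folklore] -/
def runStep (B : LevelEntryD) (C h C' : ℤ) : Option LevelEntryD :=
  bif decide (0 ≤ h) && B.toI.crudeOK P GI RbI (DI.pt h) &&
      B.toI.crudeSidesB P n GI RbI (DI.pt h) (DI.pt C) (DI.pt C') then
    match runPasses P n GI B C h C' K (passBox P n GI RbI B C h C' 0) with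
    | none => none
    | some SK =>
      bif DI.leB ((DI.pt C').sub (DI.pt C)) ((SK.toI.ρℓ P GI).mul P (DI.pt h)) &&
          DI.posB (SK.toI.ρℓ P GI) && B.toI.exitOK P GI SK.toI (DI.pt h) (DI.pt C) (DI.pt C') then
        some (B.toI.exitBox P n GI SK.toI RbI (DI.pt h) (DI.pt C) (DI.pt C')).roundOut
      else none
  else none

/-- The level a step runs towards: the next step's level, or the final level. [folklore] -/
def nextLevel (CN : ℤ) : List StepD → ℤ
  | [] => CN
  | s :: _ => s.C

/-- Table runner: the steps in order, each against the next step's level (the final level for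
the last step); returns the final entry box. [folklore] -/
def runSteps : LevelEntryD → List StepD → ℤ → Option LevelEntryD
  | B, [], _ => some B
  | B, s :: rest, CN =>
    match runStep P n K GI RbI B s.C s.h (nextLevel CN rest) with
    | none => none
    | some B' => runSteps B' rest CN

/-- [folklore] -/
theorem nextLevel_append (CN : ℤ) (xs ys : List StepD) :
    nextLevel CN (xs ++ ys) = nextLevel (nextLevel CN ys) xs := by
  cases xs <;> rfl

/-- **Chunking**: a table run over `xs ++ ys` is the run over `xs` (towards the first level of
`ys`) followed by the run over `ys`. [folklore] -/
theorem runSteps_append (B : LevelEntryD) (xs ys : List StepD) (CN : ℤ) :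
    runSteps P n K GI RbI B (xs ++ ys) CN =
      (runSteps P n K GI RbI B xs (nextLevel CN ys)).bind fun B' => runSteps P n K GI RbI B' ys CN := by
  induction xs generalizing B with
  | nil => rfl
  | cons s xs ih =>
    simp only [List.cons_append, runSteps, nextLevel_append]
    cases runStep P n K GI RbI B s.C s.h (nextLevel (nextLevel CN ys) xs) with
    | none => rfl
    | some B' => exact ih B'

/-- [folklore] -/
theorem runSteps_append_some {B₀ B₁ B₂ : LevelEntryD} {xs ys : List StepD} {CN : ℤ}
    (h₁ : runSteps P n K GI RbI B₀ xs (nextLevel CN ys) = some B₁)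
    (h₂ : runSteps P n K GI RbI B₁ ys CN = some B₂) :
    runSteps P n K GI RbI B₀ (xs ++ ys) CN = some B₂ := by
  rw [runSteps_append, h₁]
  exact h₂

end checker

namespace TableD

variable (P n K : ℕ) (GI : GateDataI) (RbI : DI) (T : TableD)

/-- The `k`-th step (past the end: the final level with cap `0`). [folklore] -/
def step (k : ℕ) : StepD := T.steps.getD k ⟨T.CN, 0⟩

/-- The entry boxes, generated from `B0` by `nextEntry`. [folklore] -/
def entry : ℕ → LevelEntryD
  | 0 => T.B0
  | k + 1 => nextEntry P n K GI RbI (entry k) (T.step k).C (T.step k).h (T.step (k + 1)).C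

/-- The real level table generated by a dyadic table. [folklore] -/
def toTable : LevelTable where
  N := T.steps.length
  C k := ((T.step k).C : ℝ) / 2 ^ P
  B k := (T.entry P n K GI RbI k).toReal P
  h k := ((T.step k).h : ℝ) / 2 ^ P
  K _ := K
  S k j := (passBox P n GI RbI (T.entry P n K GI RbI k) (T.step k).C (T.step k).h
    (T.step (k + 1)).C j).toReal P

end TableD

/-! ### Soundness of the checker -/

section sound

open DI

variable {P n K : ℕ} {GI : GateDataI} {G : GateData} {RbI : DI} {Rb : ℝ}

/-- [folklore] -/
theorem runPasses_some {B : LevelEntryD} {C h C' : ℤ} :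
    ∀ (m j : ℕ) (SK : WindowBoxD),
      runPasses P n GI B C h C' m (passBox P n GI RbI B C h C' j) = some SK →
        SK = passBox P n GI RbI B C h C' (j + m) ∧
          (∀ i ≤ m, (passBox P n GI RbI B C h C' (j + i)).toI.sidesB P GI = true) ∧
          (∀ i < m, (passBox P n GI RbI B C h C' (j + i)).toI.refineOK P n GI B.toI (DI.pt h)
            (DI.pt C) (DI.pt C') = true) := by
  intro m
  induction m with
  | zero =>
    intro j SK hrun
    simp only [runPasses] at hrun
    cases hs : (passBox P n GI RbI B C h C' j).toI.sidesB P GI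
    · simp [hs] at hrun
    · simp only [hs, cond_true, Option.some.injEq] at hrun
      refine ⟨hrun.symm, fun i hi => ?_, fun i hi => absurd hi (Nat.not_lt_zero i)⟩
      obtain rfl : i = 0 := Nat.le_zero.mp hi
      exact hs
  | succ m ih =>
    intro j SK hrun
    simp only [runPasses] at hrun
    cases hs : ((passBox P n GI RbI B C h C' j).toI.sidesB P GI &&
      (passBox P n GI RbI B C h C' j).toI.refineOK P n GI B.toI (DI.pt h) (DI.pt C) (DI.pt C'))
    · simp [hs] at hrun
    · simp only [hs, cond_true] at hrun
      simp only [Bool.and_eq_true] at hs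
      have hrun' : runPasses P n GI B C h C' m (passBox P n GI RbI B C h C' (j + 1)) = some SK :=
        hrun
      obtain ⟨h1, h2, h3⟩ := ih (j + 1) SK hrun'
      refine ⟨by rw [h1]; congr 1; omega, fun i hi => ?_, fun i hi => ?_⟩
      · rcases i with _ | i
        · simpa using hs.1
        · have := h2 i (by omega); rwa [show j + 1 + i = j + (i + 1) by omega] at this
      · rcases i with _ | i
        · simpa using hs.2
        · have := h3 i (by omega); rwa [show j + 1 + i = j + (i + 1) by omega] at this

/-- What a successful step run certifies. [folklore] -/
theorem runStep_some {B B' : LevelEntryD} {C h C' : ℤ}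
    (hrun : runStep P n K GI RbI B C h C' = some B') :
    B' = nextEntry P n K GI RbI B C h C' ∧ 0 ≤ h ∧
      B.toI.crudeOK P GI RbI (DI.pt h) = true ∧
      B.toI.crudeSidesB P n GI RbI (DI.pt h) (DI.pt C) (DI.pt C') = true ∧
      (∀ j ≤ K, (passBox P n GI RbI B C h C' j).toI.sidesB P GI = true) ∧
      (∀ j < K, (passBox P n GI RbI B C h C' j).toI.refineOK P n GI B.toI (DI.pt h) (DI.pt C)
        (DI.pt C') = true) ∧
      DI.leB ((DI.pt C').sub (DI.pt C)) (((passBox P n GI RbI B C h C' K).toI.ρℓ P GI).mul P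
        (DI.pt h)) = true ∧
      DI.posB ((passBox P n GI RbI B C h C' K).toI.ρℓ P GI) = true ∧
      B.toI.exitOK P GI (passBox P n GI RbI B C h C' K).toI (DI.pt h) (DI.pt C) (DI.pt C') =
        true := by
  simp only [runStep] at hrun
  cases hc : (decide (0 ≤ h) && B.toI.crudeOK P GI RbI (DI.pt h) &&
      B.toI.crudeSidesB P n GI RbI (DI.pt h) (DI.pt C) (DI.pt C'))
  · simp [hc] at hrun
  · simp only [hc, cond_true] at hrun
    simp only [Bool.and_eq_true, decide_eq_true_eq] at hc
    obtain ⟨⟨hh, hcr⟩, hcs⟩ := hc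
    cases hp : runPasses P n GI B C h C' K (passBox P n GI RbI B C h C' 0) with
    | none => simp [hp] at hrun
    | some SK =>
      simp only [hp] at hrun
      obtain ⟨hSK, hsides, href⟩ := runPasses_some (RbI := RbI) K 0 SK hp
      simp only [Nat.zero_add] at hSK hsides href
      subst hSK
      cases hf : (DI.leB ((DI.pt C').sub (DI.pt C))
          (((passBox P n GI RbI B C h C' K).toI.ρℓ P GI).mul P (DI.pt h)) &&
        DI.posB ((passBox P n GI RbI B C h C' K).toI.ρℓ P GI) &&
        B.toI.exitOK P GI (passBox P n GI RbI B C h C' K).toI (DI.pt h) (DI.pt C) (DI.pt C'))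
      · simp [hf] at hrun
      · simp only [hf, cond_true, Option.some.injEq] at hrun
        simp only [Bool.and_eq_true] at hf
        obtain ⟨⟨f1, f2⟩, f3⟩ := hf
        exact ⟨hrun.symm, hh, hcr, hcs, hsides, href, f1, f2, f3⟩

/-- Index shift of the generated entry boxes. [folklore] -/
theorem TableD.entry_succ_cons (B0 : LevelEntryD) (s : StepD) (rest : List StepD) (CN : ℤ) (k : ℕ) :
    TableD.entry P n K GI RbI ⟨B0, s :: rest, CN⟩ (k + 1) =
      TableD.entry P n K GI RbI ⟨TableD.entry P n K GI RbI ⟨B0, s :: rest, CN⟩ 1, rest, CN⟩ k := by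
  induction k with
  | zero => rfl
  | succ k ih =>
    rw [TableD.entry, ih]
    rfl

/-- What a successful table run certifies: every step runs, from the generated entry box to the
next one, and the final generated box is the returned one. [folklore] -/
theorem runSteps_some :
    ∀ (steps : List StepD) (B0 : LevelEntryD) (CN : ℤ) (BN : LevelEntryD),
      runSteps P n K GI RbI B0 steps CN = some BN →
        (∀ k < steps.length,
          runStep P n K GI RbI (TableD.entry P n K GI RbI ⟨B0, steps, CN⟩ k)
            ((⟨B0, steps, CN⟩ : TableD).step k).C ((⟨B0, steps, CN⟩ : TableD).step k).h
            ((⟨B0, steps, CN⟩ : TableD).step (k + 1)).C =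
            some (TableD.entry P n K GI RbI ⟨B0, steps, CN⟩ (k + 1))) ∧
        TableD.entry P n K GI RbI ⟨B0, steps, CN⟩ steps.length = BN := by
  intro steps
  induction steps with
  | nil =>
    intro B0 CN BN hrun
    simp only [runSteps, Option.some.injEq] at hrun
    exact ⟨fun k hk => absurd hk (Nat.not_lt_zero k), hrun⟩
  | cons s rest ih =>
    intro B0 CN BN hrun
    simp only [runSteps] at hrun
    cases hst : runStep P n K GI RbI B0 s.C s.h (nextLevel CN rest) with
    | none => simp [hst] at hrun
    | some B' =>
      simp only [hst] at hrun
      obtain ⟨hB', -⟩ := runStep_some hst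
      -- the step data of the cons table versus the tail table
      have hstep0 : ((⟨B0, s :: rest, CN⟩ : TableD).step 0) = s := rfl
      have hstep1 : ((⟨B0, s :: rest, CN⟩ : TableD).step 1) =
          ((⟨B', rest, CN⟩ : TableD).step 0) := rfl
      have hstepS : ∀ k, ((⟨B0, s :: rest, CN⟩ : TableD).step (k + 1)) =
          ((⟨B', rest, CN⟩ : TableD).step k) := fun k => rfl
      have hhead : nextLevel CN rest = (((⟨B', rest, CN⟩ : TableD).step 0)).C := by
        cases rest <;> rfl
      have hE1 : TableD.entry P n K GI RbI ⟨B0, s :: rest, CN⟩ 1 = B' := by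
        rw [hB', TableD.entry, TableD.entry, hstep0, hstep1, ← hhead]
      have hshift : ∀ k, TableD.entry P n K GI RbI ⟨B0, s :: rest, CN⟩ (k + 1) =
          TableD.entry P n K GI RbI ⟨B', rest, CN⟩ k := fun k => by
        rw [TableD.entry_succ_cons, hE1]
      obtain ⟨ih1, ih2⟩ := ih B' CN BN hrun
      refine ⟨fun k hk => ?_, ?_⟩
      · rcases k with _ | k
        · change runStep P n K GI RbI B0 s.C s.h (((⟨B0, s :: rest, CN⟩ : TableD).step 1)).C =
            some (TableD.entry P n K GI RbI ⟨B0, s :: rest, CN⟩ 1)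
          rw [hstep1, ← hhead, hst, hE1]
        · rw [hshift, hshift, hstepS, hstepS]
          exact ih1 k (by simpa using hk)
      · simpa [hshift] using ih2

/-- **SOUNDNESS OF THE CHECKER**: if the table run succeeds, the generated level table has valid
rows (for every real gate data and ball radius enclosed by the interval data), and the returned
box is the final entry box. [folklore] -/
theorem TableD.rowsValid_of_runSteps (hn : 0 < n) (hG : GI.Mem P G) (hRb : RbI.mem P Rb)
    (T : TableD) {BN : LevelEntryD}
    (hrun : runSteps P n K GI RbI T.B0 T.steps T.CN = some BN) :
    (T.toTable P n K GI RbI).RowsValid G Rb ∧ T.entry P n K GI RbI T.steps.length = BN := by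
  obtain ⟨hsteps, hfin⟩ := runSteps_some (P := P) (n := n) (K := K) (GI := GI) (RbI := RbI)
    T.steps T.B0 T.CN BN hrun
  refine ⟨?_, hfin⟩
  have h2P : (0 : ℝ) < 2 ^ P := pow_pos two_pos P
  -- per step
  have main : ∀ k < T.steps.length,
      let C : ℝ := ((T.step k).C : ℝ) / 2 ^ P
      let C' : ℝ := ((T.step (k + 1)).C : ℝ) / 2 ^ P
      let h : ℝ := ((T.step k).h : ℝ) / 2 ^ P
      let B := (T.entry P n K GI RbI k).toReal P
      let S : ℕ → WindowBox := fun j =>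
        (passBox P n GI RbI (T.entry P n K GI RbI k) (T.step k).C (T.step k).h
          (T.step (k + 1)).C j).toReal P
      0 ≤ h ∧ B.CrudeSides G Rb h C C' ∧ B.PassChain G Rb h C C' K S ∧
        (∀ j ≤ K, (S j).Sides G) ∧ C' - C ≤ (S K).ρℓ G * h ∧ 0 < (S K).ρℓ G ∧
        ∀ X : Fin 5 → ℝ, (B.exitBox G (S K) Rb h C C').mem G.κ G.r C' X →
          ((T.entry P n K GI RbI (k + 1)).toReal P).mem G.κ G.r C' X := by
    intro k hk C C' h B S
    obtain ⟨hnext, hh0, hcr, hcs, hsides, href, hreach, hspeed, hexit⟩ :=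
      runStep_some (hsteps k hk)
    have hC : (DI.pt (T.step k).C).mem P C := mem_pt P _
    have hC' : (DI.pt (T.step (k + 1)).C).mem P C' := mem_pt P _
    have hh : (DI.pt (T.step k).h).mem P h := mem_pt P _
    have hB : (T.entry P n K GI RbI k).toI.Mem P B := (T.entry P n K GI RbI k).toI_mem P
    have hSm : ∀ j, (passBox P n GI RbI (T.entry P n K GI RbI k) (T.step k).C (T.step k).h
        (T.step (k + 1)).C j).toI.Mem P (S j) := fun j => WindowBoxD.toI_mem P _
    refine ⟨div_nonneg (by exact_mod_cast hh0) h2P.le,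
      LevelEntryI.Mem.crudeSides hn hG hB hRb hh hC hC' hcr hcs, ⟨fun X hX => ?_, fun j hj X hX => ?_⟩,
      fun j hj => WindowBoxI.Mem.sides hG (hSm j) (hsides j hj),
      le_of_leB hreach (mem_sub hC' hC) (mem_mul (WindowBoxI.Mem.ρℓ hG (hSm K)) hh),
      pos_of_posB hspeed (WindowBoxI.Mem.ρℓ hG (hSm K)), fun X hX => ?_⟩
    · exact WindowBoxD.mem_of_containsI (WindowBoxI.containsI_roundOut _)
        (LevelEntryI.Mem.crudeBox hn hG hB hRb hh hC hC' hcr) hX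
    · exact WindowBoxD.mem_of_containsI (WindowBoxI.containsI_roundOut _)
        (WindowBoxI.Mem.refine hn hG (hSm j) hB hh hC hC' (href j hj)) hX
    · have hE := LevelEntryD.mem_of_containsE (LevelEntryI.containsE_roundOut _)
        (LevelEntryI.Mem.exitBox hn hG hB (hSm K) hRb hh hC hC' hexit) hX
      have : T.entry P n K GI RbI (k + 1) = nextEntry P n K GI RbI (T.entry P n K GI RbI k)
          (T.step k).C (T.step k).h (T.step (k + 1)).C := rfl
      rw [this]
      exact hE
  refine ⟨fun k => ?_, fun k hk => (main k hk).2.1, fun k hk => (main k hk).2.2.1,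
    fun k hk => (main k hk).2.2.2.1, fun k hk => (main k hk).2.2.2.2.1,
    fun k hk => (main k hk).2.2.2.2.2.1, fun k hk => (main k hk).2.2.2.2.2.2⟩
  by_cases hk : k < T.steps.length
  · exact (main k hk).1
  · have : T.step k = ⟨T.CN, 0⟩ := by
      simp only [TableD.step, List.getD_eq_getElem?_getD]
      rw [List.getElem?_eq_none (by omega)]
      rfl
    show (0 : ℝ) ≤ ((T.step k).h : ℝ) / 2 ^ P
    rw [this]
    simp

end sound

end Literature.Analysis.FluidPDE.FluidComputer

end
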